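import Literature.AlgebraicGeometry.Frobenioids.PerfectionFunctoriality
import Literature.AlgebraicGeometry.Frobenioids.EquivalenceFrobeniusQuasiIsotropic
import HarnessLib

/-!
# Frobenioids I, Theorem 3.4 (iii), the perfection square for quasi-isotropic Frobenioids over
# FSM-type bases (PROOFS — the glue of sub-node `FrdI:Thm3.4(iii)/L01p PfSquare`)

Mochizuki, *The geometry of Frobenioids I: the general theory*, Kyushu J. Math. **62** (2008), Theorem
3.4 (iii), p. 62 l. 42 – p. 63 l. 2 [cite: MochizukiFrdI2008, Thm. 3.4 (iii) p.62]: "`Ψ` induces a … functor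
`Ψ^pf : C₁^pf → C₂^pf` that fits into a `1`-commutative diagram [with `C_i → C_i^pf`]". This file instantiates
the hypothesis-decoupled construction `PreFrobenioid.Perfection.map` (`PerfectionFunctoriality.lean`, seat
abc-iut-L1-d1) with the Frobenius-type / Frobenius-degree preservation proved by seat abc-iut-L1-t13 for
quasi-isotropic Frobenioids over FSM-type bases with non-dilating divisor monoids and a non-group-like object
on each side (`FrdI.thm34iii_morphisms_of_isOfFSMType`, `EquivalenceFrobeniusQuasiIsotropic.lean` — the
cell's repaired hypothesis set, sub-DAG `plan/L1/SUBDAG-FrdI-Thm34.md` row L01/L01p):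

* `isFrobeniusCompatible_of_isOfFSMType` — under those hypotheses `Ψ` is Frobenius-compatible;
* `thm34iii_pfSquare_of_isOfFSMType` — for THE perfections `PreFrobenioidData.perfection hF_i` there is
  `Ψ^pf : C₁^pf ⥤ C₂^pf`, an EQUIVALENCE, with `Ψ ⋙ (C₂ → C₂^pf) ≅ (C₁ → C₁^pf) ⋙ Ψ^pf` — the first two
  conjuncts of `OneUniqueSquare Ψ.functor P₁.toPf P₂.toPf Ψ^pf` in t3's typed `Thm34iii_pf` (the `1`-uniqueness
  conjunct and the rigidity conjunct are separate sub-nodes).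
-/

namespace Literature.AlgebraicGeometry.Frobenioids

namespace FrdI

open CategoryTheory Opposite

universe w v v' u u'

variable {D₁ : Type u} [Category.{v} D₁] {Φ₁ : D₁ᵒᵖ ⥤ CommMonCat.{w}} {C₁ : Type u'}
  [Category.{v'} C₁] {D₂ : Type u} [Category.{v} D₂] {Φ₂ : D₂ᵒᵖ ⥤ CommMonCat.{w}} {C₂ : Type u'}
  [Category.{v'} C₂] {F₁ : C₁ ⥤ ElemFrobenioid Φ₁} {F₂ : C₂ ⥤ ElemFrobenioid Φ₂}

/-- Under the hypotheses of `thm34iii_morphisms_of_isOfFSMType` (quasi-isotropic type, FSM-type bases,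
non-dilating divisor monoids, a non-group-like object on each side), an equivalence `Ψ : C₁ ≌ C₂` carries arrows
of Frobenius type to arrows of Frobenius type of the same Frobenius degree, i.e. is Frobenius-compatible in
the sense of `PerfectionFunctoriality.lean`. [cite: MochizukiFrdI2008, Thm. 3.4 (iii) p.62] -/
theorem isFrobeniusCompatible_of_isOfFSMType (hF₁ : PreFrobenioid.IsFrobenioid F₁)
    (hF₂ : PreFrobenioid.IsFrobenioid F₂) (hq₁ : (PreFrobenioidData.ofFunctor Φ₁ F₁).IsOfQuasiIsotropicType)
    (hq₂ : (PreFrobenioidData.ofFunctor Φ₂ F₂).IsOfQuasiIsotropicType) (hD₁ : IsOfFSMType D₁)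
    (hD₂ : IsOfFSMType D₂) (hnd₁ : (PreFrobenioidData.ofFunctor Φ₁ F₁).IsNonDilatingOn)
    (hnd₂ : (PreFrobenioidData.ofFunctor Φ₂ F₂).IsNonDilatingOn) (Ψ : C₁ ≌ C₂)
    (hN₁ : ∃ A : C₁, ¬ (PreFrobenioidData.ofFunctor Φ₁ F₁).IsGroupLikeObj A)
    (hN₂ : ∃ A : C₂, ¬ (PreFrobenioidData.ofFunctor Φ₂ F₂).IsGroupLikeObj A) :
    PreFrobenioid.IsFrobeniusCompatible F₁ F₂ Ψ.functor := by
  obtain ⟨⟨hfr, -, -, -, -, -, -⟩, ΨN, hdeg, hΨN⟩ :=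
    thm34iii_morphisms_of_isOfFSMType hF₁ hF₂ hq₁ hq₂ hD₁ hD₂ hnd₁ hnd₂ Ψ hN₁ hN₂
  subst hΨN
  refine ⟨fun A B f hf => ?_, fun A B f _ => ?_⟩
  · exact (PreFrobenioidData.ofFunctor_isFrobeniusType F₂ _).mp
      (hfr f ((PreFrobenioidData.ofFunctor_isFrobeniusType F₁ f).mpr hf))
  · simpa only [PreFrobenioidData.ofFunctor_degFr, MulEquiv.refl_apply] using hdeg f

/-- **Theorem 3.4 (iii), perfection square, over FSM-type bases** (sub-node L01p): for THE perfections of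
`C₁`, `C₂` there is a functor `Ψ^pf : C₁^pf → C₂^pf` which is an EQUIVALENCE of categories and makes the square
with `C_i → C_i^pf` `1`-commute (the first two conjuncts of `OneUniqueSquare` in the typed `Thm34iii_pf`).
[cite: MochizukiFrdI2008, Thm. 3.4 (iii) p.62] -/
theorem thm34iii_pfSquare_of_isOfFSMType (hF₁ : PreFrobenioid.IsFrobenioid F₁)
    (hF₂ : PreFrobenioid.IsFrobenioid F₂) (hq₁ : (PreFrobenioidData.ofFunctor Φ₁ F₁).IsOfQuasiIsotropicType)
    (hq₂ : (PreFrobenioidData.ofFunctor Φ₂ F₂).IsOfQuasiIsotropicType) (hD₁ : IsOfFSMType D₁)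
    (hD₂ : IsOfFSMType D₂) (hnd₁ : (PreFrobenioidData.ofFunctor Φ₁ F₁).IsNonDilatingOn)
    (hnd₂ : (PreFrobenioidData.ofFunctor Φ₂ F₂).IsNonDilatingOn) (Ψ : C₁ ≌ C₂)
    (hN₁ : ∃ A : C₁, ¬ (PreFrobenioidData.ofFunctor Φ₁ F₁).IsGroupLikeObj A)
    (hN₂ : ∃ A : C₂, ¬ (PreFrobenioidData.ofFunctor Φ₂ F₂).IsGroupLikeObj A) :
    ∃ Ψpf : (PreFrobenioidData.perfection hF₁).Pf ⥤ (PreFrobenioidData.perfection hF₂).Pf,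
      Ψpf.IsEquivalence ∧ OneCommutes Ψ.functor (PreFrobenioidData.perfection hF₂).toPf
        (PreFrobenioidData.perfection hF₁).toPf Ψpf := by
  have hΨ := isFrobeniusCompatible_of_isOfFSMType hF₁ hF₂ hq₁ hq₂ hD₁ hD₂ hnd₁ hnd₂ Ψ hN₁ hN₂
  exact ⟨PreFrobenioid.Perfection.map (hF₁ := hF₁) (hF₂ := hF₂) hΨ,
    PreFrobenioid.Perfection.map_isEquivalence (hF₁ := hF₁) (hF₂ := hF₂) Ψ hΨ,
    ⟨(PreFrobenioid.Perfection.toPfCompMapIso (hF₁ := hF₁) (hF₂ := hF₂) hΨ).symm⟩⟩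

/-- The square for THE perfections, with the chosen `Ψ^pf = Perfection.map`: `Ψ^pf` is an equivalence and
`Ψ ⋙ toPf ≅ toPf ⋙ Ψ^pf`. [cite: MochizukiFrdI2008, Thm. 3.4 (iii) p.62] -/
theorem perfectionMap_isEquivalence_of_isOfFSMType (hF₁ : PreFrobenioid.IsFrobenioid F₁)
    (hF₂ : PreFrobenioid.IsFrobenioid F₂) (hq₁ : (PreFrobenioidData.ofFunctor Φ₁ F₁).IsOfQuasiIsotropicType)
    (hq₂ : (PreFrobenioidData.ofFunctor Φ₂ F₂).IsOfQuasiIsotropicType) (hD₁ : IsOfFSMType D₁)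
    (hD₂ : IsOfFSMType D₂) (hnd₁ : (PreFrobenioidData.ofFunctor Φ₁ F₁).IsNonDilatingOn)
    (hnd₂ : (PreFrobenioidData.ofFunctor Φ₂ F₂).IsNonDilatingOn) (Ψ : C₁ ≌ C₂)
    (hN₁ : ∃ A : C₁, ¬ (PreFrobenioidData.ofFunctor Φ₁ F₁).IsGroupLikeObj A)
    (hN₂ : ∃ A : C₂, ¬ (PreFrobenioidData.ofFunctor Φ₂ F₂).IsGroupLikeObj A) :
    (PreFrobenioid.Perfection.map (hF₁ := hF₁) (hF₂ := hF₂)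
        (isFrobeniusCompatible_of_isOfFSMType hF₁ hF₂ hq₁ hq₂ hD₁ hD₂ hnd₁ hnd₂ Ψ hN₁ hN₂)).IsEquivalence :=
  PreFrobenioid.Perfection.map_isEquivalence Ψ _

end FrdI

end Literature.AlgebraicGeometry.Frobenioids
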